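import Summits.BirchSwinnertonDyer.BirchSwinnertonDyer.Theses.SignedLowerHalves
import Summits.BirchSwinnertonDyer.BirchSwinnertonDyer.Theorems.SignedLowerHalvesKobayashiLowerHalfLargeImageMuPartRational
import HarnessLib

/-!
# Route `SignedLowerHalves`, crux 3 `KobayashiLowerHalfLargeImage` (item stmt-BirchSwinnertonDyer-19001):
# crux 3 BY NAME ⟺ its RATIONAL (`Λ ⊗ ℚ_p`) version, and the registered residue `stub_three` of the line of record
# `kurihara_rigidity` ⟺ its rational version modulo PUBLISHED facts only
# (cell `bsd-ssimc`, width seat `bsd-line-slh-p1-w6` gen 0; `--supports 19001`; CALIBRATION ONLY; imports the route file)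

HONEST FRAMING.  The crux is OPEN and nothing here proves it; BSD is not proved by any of this.  This file reads the
route-independent theorem `LargeImageMuPartRational.kobayashiLowerDivisibility_iff_rational` (for EVERY sign,
`KobayashiLowerDivisibility W p ε` ⟺ «`char X^ε = (g)`, `L_p^ε ∣ p^t·g`» at an odd good supersingular prime with `ρ̄` onto,
modulo the PUBLISHED named facts `h12`, `h41`, `h5`, `h3`, `hJ` and — only at `p ≥ 5` — Conjecture B⁰) on the crux's
class X7:

* `kobayashiLowerHalfLargeImage_of_rational` / `kobayashiLowerHalfLargeImage_iff_rational`: crux 3 BY NAME ⟸ / ⟺ «at every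
  pair of the class SOME sign has the rational Eisenstein divisibility» (granted the facts and B⁰);
* **`kuriharaRigidity_stub_three_iff_rational`**: the body of the REGISTERED stub `KuriharaRigidity.stub_three` (skeleton
  `Lines/kurihara_rigidity.lean` r2, VERBATIM) ⟺ its rational version, modulo PUBLISHED facts ONLY (no B⁰ at `p = 3`: the
  μ-floor is input-free there).  So the LEAD's O2/O3 at `p = 3` are statements in `Λ ⊗ ℚ_p`; any engine at `3` that
  delivers the Eisenstein divisibility rationally (before a μ-step) closes `stub_three` at its pairs.

CALIBRATION / SUPPORT ONLY (pen rule D34-4 (3)): never an input to a registered stub, a `closes`, or a by-name close of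
item 19001; not a proof of `stub_three`.

References: [Kobayashi2003] Conjecture (p. 2), Thm. 1.2, Thm. 4.1, proof of Thm. 7.4 (p. 13); [GreenbergVatsal2000] p. 4,
§3 Rem. 3.4; [PollackWeston2011] Rem. 4.2; [Vaserstein1972SL2] Theorem; [Serre1972] §1.11 Prop. 12.
-/

-- D-0017: single-problem summit, the namespace repeats the problem name by design.
set_option linter.dupNamespace false
set_option autoImplicit false

noncomputable section

open scoped Classical MatrixGroups ModularForm

open CongruenceSubgroup WeierstrassCurve Literature.NumberTheory.EllipticCurves
  Literature.NumberTheory.EllipticCurves.ModularForms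
  Literature.NumberTheory.EllipticCurves.Kobayashi2003 Literature.NumberTheory.EllipticCurves.GreenbergVatsal2000
  Literature.NumberTheory.EllipticCurves.Rank1Residual ZpExtension
  Summit.BirchSwinnertonDyer.Rank1Residual.Supersingular

namespace Summit.BirchSwinnertonDyer.BirchSwinnertonDyer.Theorems.LargeImageMuPartRationalCrux

open Summit.BirchSwinnertonDyer.Rank1Residual.X1.MuLambda (mu)
open Summit.BirchSwinnertonDyer.BirchSwinnertonDyer.Cruxes.AnalyticMuZeroX9.TeichSpan (TeichSpanGenAll)
open Summit.BirchSwinnertonDyer.BirchSwinnertonDyer.Theorems.LargeImageMuPartRational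
  (kobayashiLowerDivisibility_iff_rational hasIrreducibleModPGaloisRep_of_apZero)
open Summit.BirchSwinnertonDyer.BirchSwinnertonDyer.Theorems.MuSplit
  (kobayashiLowerDivisibility_iff_dvd_C_pow_mul_and_mu_le kobayashiLowerDivisibility_of_dvd_C_pow_mul_of_mu_le)

/-! ## §3 Readings on the crux's class (X7) — imports the route file; CALIBRATION ONLY -/

section Crux

/-- **Crux 3 BY NAME from a RATIONAL Eisenstein divisibility for one sign per pair.**  GRANTED `h12`, `h41`, `h5`, `h3`,
`hJ` (PUBLISHED) and B⁰ (only `p ≥ 5`): if at every pair of the crux's class (`p` odd, X7, non-CM, `a_p = 0`, onto) SOME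
sign `ε` has the rational Eisenstein divisibility `L_p^ε ∣ p^t·(generator of char X^ε)` for every datum, then
`SignedLowerHalves.KobayashiLowerHalfLargeImage`.  CALIBRATION ONLY.
[cite: Kobayashi2003, Conjecture (Main Conjecture) (p. 2)] [cite: GreenbergVatsal2000, p. 4] -/
theorem kobayashiLowerHalfLargeImage_of_rational
    (h12 : Kobayashi2003.thm12_signedSelmerDual_finite_torsion)
    (h41 : Kobayashi2003.thm41_signedCharIdeal_divisibility)
    (h5 : realPeriodRat_eq_unit_mul_plusPeriod) (h3 : realPeriodRat_eq_unit_mul_plusPeriod_three)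
    (hJ : Kobayashi2003.thm62_63_73_signedColemanKato_zetaJoint) (hB : TeichSpanGenAll)
    (hR : ∀ (W : WeierstrassCurve ℚ) [W.IsElliptic] [W.IsGloballyMinimal] (p : ℕ) [Fact p.Prime],
      p ≠ 2 → ClassX7 W p → ¬ W.HasCM → W.frobeniusTrace p = 0 → Surj W p → ∃ ε : ℤˣ,
      ∀ (κ : ZpExtension ℚ p) (γ : Field.absoluteGaloisGroup ℚ),
        κ.IsCyclotomic → κ.IsTopGenerator γ → IsCyclotomicVariable p γ →
        ∀ [NeZero (W.conductorNorm ℤ)] (f : CuspForm (Gamma0 (W.conductorNorm ℤ)) 2),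
          IsNewformOf W f → ∀ (ϖ : ℚ), (ϖ : ℝ) * W.realPeriodRat = plusPeriod f →
        ∀ (Lplus Lminus : IwasawaAlgebra p), IsPollackPair f p Lplus Lminus →
        ∀ (D : SignedSelmerDualData W κ γ ε),
          ∃ (g : IwasawaAlgebra p) (t : ℕ), D.charIdeal = Ideal.span {g} ∧
            kobayashiL ε Lplus Lminus ∣ PowerSeries.C (p : ℤ_[p]) ^ t * g) :
    Summit.BirchSwinnertonDyer.BirchSwinnertonDyer.Theses.SignedLowerHalves.KobayashiLowerHalfLargeImage := by
  intro W _ _ p _ hp hX7 hCM hap hS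
  obtain ⟨ε, hε⟩ := hR W p hp hX7 hCM hap hS
  exact ⟨ε, (kobayashiLowerDivisibility_iff_rational h12 h41 h5 h3 hJ hB hp hX7.1.1 hap hS ε).mpr hε⟩

/-- **Crux 3 BY NAME ⟺ its rational version** (granted the published facts and B⁰, the latter only at `p ≥ 5`).
CALIBRATION ONLY. [cite: Kobayashi2003, Conjecture (Main Conjecture) (p. 2)] [cite: GreenbergVatsal2000, p. 4] -/
theorem kobayashiLowerHalfLargeImage_iff_rational
    (h12 : Kobayashi2003.thm12_signedSelmerDual_finite_torsion)
    (h41 : Kobayashi2003.thm41_signedCharIdeal_divisibility)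
    (h5 : realPeriodRat_eq_unit_mul_plusPeriod) (h3 : realPeriodRat_eq_unit_mul_plusPeriod_three)
    (hJ : Kobayashi2003.thm62_63_73_signedColemanKato_zetaJoint) (hB : TeichSpanGenAll) :
    Summit.BirchSwinnertonDyer.BirchSwinnertonDyer.Theses.SignedLowerHalves.KobayashiLowerHalfLargeImage ↔
    ∀ (W : WeierstrassCurve ℚ) [W.IsElliptic] [W.IsGloballyMinimal] (p : ℕ) [Fact p.Prime],
      p ≠ 2 → ClassX7 W p → ¬ W.HasCM → W.frobeniusTrace p = 0 → Surj W p → ∃ ε : ℤˣ,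
      ∀ (κ : ZpExtension ℚ p) (γ : Field.absoluteGaloisGroup ℚ),
        κ.IsCyclotomic → κ.IsTopGenerator γ → IsCyclotomicVariable p γ →
        ∀ [NeZero (W.conductorNorm ℤ)] (f : CuspForm (Gamma0 (W.conductorNorm ℤ)) 2),
          IsNewformOf W f → ∀ (ϖ : ℚ), (ϖ : ℝ) * W.realPeriodRat = plusPeriod f →
        ∀ (Lplus Lminus : IwasawaAlgebra p), IsPollackPair f p Lplus Lminus →
        ∀ (D : SignedSelmerDualData W κ γ ε),
          ∃ (g : IwasawaAlgebra p) (t : ℕ), D.charIdeal = Ideal.span {g} ∧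
            kobayashiL ε Lplus Lminus ∣ PowerSeries.C (p : ℤ_[p]) ^ t * g := by
  refine ⟨fun h W _ _ p _ hp hX7 hCM hap hS ↦ ?_, kobayashiLowerHalfLargeImage_of_rational h12 h41 h5 h3 hJ hB⟩
  obtain ⟨ε, hε⟩ := h W p hp hX7 hCM hap hS
  exact ⟨ε, (kobayashiLowerDivisibility_iff_rational h12 h41 h5 h3 hJ hB hp hX7.1.1 hap hS ε).mp hε⟩

/-- **The registered residue `KuriharaRigidity.stub_three` of the line of record ⟺ its RATIONAL version, modulo PUBLISHED
facts only.**  The body of `stub_three` (skeleton `Lines/kurihara_rigidity.lean` r2, VERBATIM: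
`p = 3 → ClassX7 W p → ¬ W.HasCM → W.frobeniusTrace p = 0 → Surj W p → ∃ ε, KobayashiLowerDivisibility W p ε`) is
EQUIVALENT, granted `h12`, `h41`, `h5`, `h3`, `hJ` (all PUBLISHED; NO B⁰ — at `p = 3` the μ-floor is input-free), to the
same statement with `KobayashiLowerDivisibility W p ε` replaced by its rational part.  So O2/O3 of the LEAD's line report
at `p = 3` are statements in `Λ ⊗ ℚ_p`.  CALIBRATION ONLY (not a proof of the stub).
[cite: Kobayashi2003, Conjecture (Main Conjecture) (p. 2)] [cite: Vaserstein1972SL2, Theorem] [cite: PollackWeston2011, Rem. 4.2] -/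
theorem kuriharaRigidity_stub_three_iff_rational
    (h12 : Kobayashi2003.thm12_signedSelmerDual_finite_torsion)
    (h41 : Kobayashi2003.thm41_signedCharIdeal_divisibility)
    (h5 : realPeriodRat_eq_unit_mul_plusPeriod) (h3 : realPeriodRat_eq_unit_mul_plusPeriod_three)
    (hJ : Kobayashi2003.thm62_63_73_signedColemanKato_zetaJoint) :
    (∀ (W : WeierstrassCurve ℚ) [W.IsElliptic] [W.IsGloballyMinimal] (p : ℕ) [Fact p.Prime],
      p = 3 → ClassX7 W p → ¬ W.HasCM → W.frobeniusTrace p = 0 → Surj W p →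
      ∃ ε : ℤˣ, KobayashiLowerDivisibility W p ε) ↔
    ∀ (W : WeierstrassCurve ℚ) [W.IsElliptic] [W.IsGloballyMinimal] (p : ℕ) [Fact p.Prime],
      p = 3 → ClassX7 W p → ¬ W.HasCM → W.frobeniusTrace p = 0 → Surj W p → ∃ ε : ℤˣ,
      ∀ (κ : ZpExtension ℚ p) (γ : Field.absoluteGaloisGroup ℚ),
        κ.IsCyclotomic → κ.IsTopGenerator γ → IsCyclotomicVariable p γ →
        ∀ [NeZero (W.conductorNorm ℤ)] (f : CuspForm (Gamma0 (W.conductorNorm ℤ)) 2),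
          IsNewformOf W f → ∀ (ϖ : ℚ), (ϖ : ℝ) * W.realPeriodRat = plusPeriod f →
        ∀ (Lplus Lminus : IwasawaAlgebra p), IsPollackPair f p Lplus Lminus →
        ∀ (D : SignedSelmerDualData W κ γ ε),
          ∃ (g : IwasawaAlgebra p) (t : ℕ), D.charIdeal = Ideal.span {g} ∧
            kobayashiL ε Lplus Lminus ∣ PowerSeries.C (p : ℤ_[p]) ^ t * g := by
  constructor
  · intro h W _ _ p _ hp3 hX7 hCM hap hS
    obtain ⟨ε, hε⟩ := h W p hp3 hX7 hCM hap hS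
    subst hp3
    refine ⟨ε, ?_⟩
    intro κ γ hκ hγ hv _ f hf ϖ hϖ Lplus Lminus hPP D
    have hirr : W.HasIrreducibleModPGaloisRep 3 := hasIrreducibleModPGaloisRep_of_apZero (by decide) hX7.1.1 hap
    obtain ⟨g, t, hchar, hdvd, -⟩ :=
      (kobayashiLowerDivisibility_iff_dvd_C_pow_mul_and_mu_le W 3 h5 h3 (by decide) hX7.1.1 hirr ε).mp hε
        κ γ hκ hγ hv f hf ϖ hϖ Lplus Lminus hPP D
    exact ⟨g, t, hchar, hdvd⟩
  · intro h W _ _ p _ hp3 hX7 hCM hap hS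
    obtain ⟨ε, hε⟩ := h W p hp3 hX7 hCM hap hS
    subst hp3
    have hirr : W.HasIrreducibleModPGaloisRep 3 := hasIrreducibleModPGaloisRep_of_apZero (by decide) hX7.1.1 hap
    refine ⟨ε, kobayashiLowerDivisibility_of_dvd_C_pow_mul_of_mu_le W 3 h5 h3 (by decide) hX7.1.1 hirr ε ?_⟩
    intro κ γ hκ hγ hv _ f hf ϖ hϖ Lplus Lminus hPP D
    obtain ⟨g, t, hchar, hdvd⟩ := hε κ γ hκ hγ hv f hf ϖ hϖ Lplus Lminus hPP D
    obtain ⟨hmu, -⟩ := LargeImageMuPart.mu_charGen_eq_mu_kobayashiL_three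
      h12 h41 h5 h3 hJ rfl hX7.1.1 hap hS hκ hγ hv hf hPP ε D hchar
    exact ⟨g, t, hchar, hdvd, le_of_eq hmu.symm⟩

end Crux

end Summit.BirchSwinnertonDyer.BirchSwinnertonDyer.Theorems.LargeImageMuPartRationalCrux

end
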